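/-
Copyright: cell `pub-ymgap` (HUMAN RULING D-0062), Track A of `YM-PLAN.md`, DAG node N20 (= NE7b); R134 seat `pub-ymgap-dag-n20-d`
(strategy s3 «alternative currency», generation 6), module 9.  Released under the licence of the surrounding project.
-/
import Summits.QuantumFields.YangMills.Theorems.BalabanUVNodesN20LCSLabelTowerByValue
import Summits.QuantumFields.YangMills.Theorems.BalabanUVNodesN20ByValueAtRecord
import Summits.QuantumFields.YangMills.Theorems.BalabanUVNodesN20ByValueLadderCells
import HarnessLib

/-!
# YM-DAG node N20 (= NE7b), strategy s3, THE FOURTH CURRENCY «BY VALUE» (module 9): KEYS PINNED AT ANY SET OF LEVELS ON BAŁABAN's LABEL TOWER OF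
# RECORD — the class weight of a label-family pattern pinning large-field families at the levels `j ∈ J` is AT MOST THE WILSON–GIBBS PROBABILITY OF
# THE JOINT COARSE LARGE-FIELD EVENT OF ITS PINNED LEVELS times `∫ρ₀`; for ONE pinned level `k` — any `k`, not only the first step — this is ONE
# PEIERLS FACTOR PER PINNED CUBE, with NO «LCS-k» hypothesis

Track A of `YM-PLAN.md` (cell `pub-ymgap`, HUMAN RULING D-0062), node **N20** = spine estimate NE7b (`T4WeightBudget.RelWeightBound` — the cell
`pub-balaban`'s OWN estimate, NOT PRINTED in [Bałaban 1983–89], NOT PROVED).  Seat `pub-ymgap-dag-n20-d` (R134, s3), generation 6, module 9 (after module 8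
`…N20ByValueLadderCells`).  Kernel theorems only: 0 `def`, 0 `sorry`, standard axioms; COUNT-NEUTRAL (`--supports` K3⁗ `SpineGivenEndpointR13Sep`,
stmt-QuantumFields-20292, `--as helper`).  Restate-immune (no Theses import).

WHY.  Seat `pub-ymgap-dag-n20-c` built THE LABEL TOWER OF RECORD (`N20LCSLabelTower.labelTowerOfRecord`, module 27: Bałaban's T-steps with the
[Balaban1988Convergent] §3 label weights, conditional-expectation currency), proved the (α)-road's class weight bound on it for keys ROOTED AT THE FIRST
STEP (module 28), proved that it HAS generation 5's MODULE PROPERTY (`N20LCSLabelTowerByValue.hmod_labelTower`, module 29 — one declarer: n20-c) and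
displayed, for keys rooted at a LATER step `k`, the bound CONDITIONAL on «LCS-k» (a local exponential plaquette moment in the history term's own dressed
state, `N20LCSLabelTowerPinnedLevel`, module 30) — the (α)-road's located residual.  In the fourth currency there is no dressed state: by
`hmod_labelTower` every class weight telescopes BY VALUE to the bare level-`0` field (`sum_admS_integral_labelTower_eq`), where the pinned letters of
ALL pinned levels are indicators of coarse large-field events of the ITERATED BLOCK AVERAGES `Ū^{j+1}` and `ρ₀·dU₀` IS the Wilson–Gibbs state at
`β = g₀⁻²` (`N20LCSLargeFieldFirstStep.setIntegral_rhoZeroOfRecord`).  THIS FILE draws the consequence n20-c reserved for this seat (bus l.17148):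
* §1 ★ `sum_labelChi_pinned_le_indicator` — under the two ζ-laws and the regularity letters, the step kernels of the labels of a family pinning `D`
  (`t ∈ E → D ⊆ P(t)`) sum to at most `𝟙[∀ c ∈ D, ∃ p′ ∈ R c, ε ≤ |Ū(∂p′) − 1|]` read on the graph (n20-c's `hread_labelTower` +
  `abs_sum_ωOfRecord_sub_le_indicator`); `sum_labelChi_free_eq_one` (a free level sums to `1`, `hunit_labelTower`).
* §2 ★★★ **`sum_admS_integral_labelTower_le_gibbsReal_mul`** — THE REDUCTION: for a label-family pattern `E` pinning level-indexed families `D j` at the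
  levels `j ∈ J` (regularity letters `R j`, thresholds `ε j`) and FREE at every other level, at every cutoff `K′`,
  `Σ_{h ∈ admS (labelTowerOfRecord A₁ ζ) (labelPattern E) K′} ∫ eterm ρ₀ K′ h dμ_{K′}
     ≤ μ_{g₀⁻²}{U | ∀ j ∈ J, j < K′ → ∀ c ∈ D j, ∃ p′ ∈ R j c, ε j ≤ |Ū^{j+1}U(∂p′) − 1|} · ∫ ρ₀ dU₀`
  (`μ_{g₀⁻²} = T4GenFunBounds.gibbsMeasure (F.P K) g₀⁻²`, `Ū^{j} = iterMap avg j U`) — NE7b's per-class residual ON THE OBJECT is ONE joint coarse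
  large-field probability of the pinned levels under the bare Wilson–Gibbs state: no conditioning, no floor, no «LCS-j» (generation 5's module 2
  `sum_admS_integral_le_integral_prod` with `hmod_labelTower`, letters `e_j = 𝟙[event_j] ∘ avg_j` at `j ∈ J`, `1` elsewhere).
* §3 ★★★ **`sum_admS_integral_le_labelTower_pinnedLevel_byValue`** — ONE PINNED LEVEL `k`, ANY `k < K`, UNCONDITIONALLY: with the `δ_{k+1} > 0`,
  `C_{k+1} ≥ 0` of module 8's `gibbsMeasure_largeFieldCells_dist1_iterAvgFun_le` at level `k + 1` (functions of `N`, `L`, `k`), for `g₀⁻² ≥ 4N`, a finite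
  family `D` of χ_{k+1}-cubes with regularity letters on pairwise disjoint regions of `≤ m` plaquettes, `ε″ ≥ 0`, every cutoff `K′ > k` and every
  label-family pattern pinning `D` at level `k` and free elsewhere,
  `Σ_{h ∈ admS … K′} ∫ eterm ρ₀ K′ h dμ_{K′} ≤ (m·e^{C_{k+1}δ_{k+1} − δ_{k+1}g₀⁻²ε″²∕(2N)})^{#D} · ∫ ρ₀ dU₀`
  — n20-c module 30's conclusion (`sum_admS_integral_le_labelTower_pinnedLevel`) for the initial density of record WITHOUT its «LCS-k» hypothesis
  (and without the transfer guard ∕ window): the histories whose level-`k` label pins `D` large weigh, at every later level, at most one level-`(k+1)`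
  Peierls factor per pinned cube times the whole; `…_rel` = END2's `extractA` shape (`≤ q ×` the full sum, n20-c's `sum_adm_integral_eterm_labelTower`).

HONEST FRAMING.  Count-neutral kernel theorems on n20-c's object + an instance with LETTER-BASED, LEVEL-DEPENDENT constants: module 8's `δ_{k+1}`,
`C_{k+1}` degrade geometrically in `k`, so the Peierls factor of §3 is small only for `g₀⁻²ε″²` large against `(A·M)^{k+1}` — the located wall of NE7b in
the fourth currency (LEVEL-UNIFORM constants = Bałaban's inductive small-field analysis, print's KIND [Balaban1989LargeFieldII] (1.79) p. 383, NOT print's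
statement) is exactly what separates §3 from a summable `W_K`; §2 says the multi-level residual is a JOINT sparseness bound (two levels: module 8 §3),
nothing conditional.  Residual binders as in n20-c's modules 28–30: the two ζ-laws, the (O4) measurability, the per-cube regularity letters
([Balaban1985Variational] Thm 1 p. 279 — NOT asserted), disjoint letter regions.  Nothing of Bałaban's is asserted; NE7b NOT PRINTED ∕ NOT PROVED; the
(α)-instance 0∕1; N20 NOT discharged (typed 28∕28, discharged count untouched); one finite four-torus programme at fixed `ε` — NOT ℝ⁴, NOT infinite
volume, NOT OS, NOT a mass gap, NOT Clay.  References (LOCATORS only; no decl carries a cite tag): T. Bałaban, CMP **119** (1988) 243–285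
[Balaban1988Convergent] ((3.1)–(3.5) pp. 264–265); CMP **122** (1989) 175–202 [Balaban1989LargeFieldI] ((0.1) p. 175, (0.3)–(0.4) p. 176); CMP **122**
(1989) 355–392 [Balaban1989LargeFieldII] ((1.79) p. 383).
-/

set_option autoImplicit false

noncomputable section

open scoped BigOperators

namespace Summit.QuantumFields.YangMills.BalabanUVNodes.N20ByValueLabelTowerPinned

open MeasureTheory
open Literature.MathematicalPhysics.QuantumFieldTheory.Balaban1983to89
open Literature.MathematicalPhysics.QuantumFieldTheory.Balaban1983to89.T4Continuum
open Literature.MathematicalPhysics.QuantumFieldTheory.Balaban1983to89.Node00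
open Summit.QuantumFields.BalabanUV.T4Continuum.B16HistoryIndexedRepr (GoodClass)
open Summit.QuantumFields.BalabanUV.T4Continuum.B16HistoryReprChain
open Summit.QuantumFields.BalabanUV.T4Continuum.NE7b.PrefixExtraction (admS admS_subset_adm)
open Summit.QuantumFields.BalabanUV.T4Continuum.ShellMeasureAverageIterate (iterMap iterMap_zero iterMap_succ)
open Summit.QuantumFields.YangMills.BalabanUVNodes.N20LCSLabelTower
open Summit.QuantumFields.YangMills.BalabanUVNodes.N20LCSLabelTowerClassWeight
  (labelChi_eq hread_labelTower hunit_labelTower sum_adm_integral_eterm_labelTower)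
open Summit.QuantumFields.YangMills.BalabanUVNodes.N20LCSLabelTowerByValue (good_comp_avOfRecord hmod_labelTower)
open Summit.QuantumFields.YangMills.BalabanUVNodes.N20LCSLargeFieldSubfamilies (abs_sum_ωOfRecord_sub_le_indicator)
open Summit.QuantumFields.YangMills.BalabanUVNodes.N20LCSLargeFieldSparsify (zeta_nonneg_of_laws)
open Summit.QuantumFields.YangMills.BalabanUVNodes.N20LCSLargeFieldFamilies (measurableSet_forall_exists_largeField)
open Summit.QuantumFields.YangMills.BalabanUVNodes.N20LCSLargeFieldFirstStep (setIntegral_rhoZeroOfRecord)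
open Summit.QuantumFields.YangMills.BalabanUVNodes.N20ByValueTelescoping (good_prod_iterMap)
open Summit.QuantumFields.YangMills.BalabanUVNodes.N20ByValueExtraction (sum_admS_integral_le_integral_prod)
open Summit.QuantumFields.YangMills.BalabanUVNodes.N20ByValueAtRecord (iterMap_avg_eq_iter)
open Summit.QuantumFields.YangMills.BalabanUVNodes.N20ByValueLadderCells (gibbsMeasure_largeFieldCells_dist1_iterAvgFun_le)

variable (F : T4Family) (N : ℕ) [NeZero N] (ν : Stage7Numerics) (M : ℕ) (p : B12.RunParams) (g : ℕ → ℝ)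

/-! ## §1 The pinned step kernels of a label family sum to at most the indicator of the family's coarse large-field event -/

section Letters

variable {A₁ : ℝ} {ζ : ZetaOfRecord F N ν M}

/-- ★ **THE PINNED-SUM LETTER OF A LABEL FAMILY** (generation 5's `hpin` row on the label tower): under the two ζ-laws and the regularity letters of the
pinned cubes, for a label family `E j h` pinning `D` (`t ∈ E j h → D ⊆ P(t)`), the step kernels of its choices after `h` sum pointwise to at most the
indicator of the coarse event «every pinned cube has a large plaquette of the block average», read on the graph `V′ = Ū`:
`Σ_{q ∈ branch ∩ labelPattern E j h} labelChi j h q U ≤ 𝟙[∀ c ∈ D, ∃ p′ ∈ R c, ε ≤ |Ū(∂p′) − 1|]`. [folklore] -/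
theorem sum_labelChi_pinned_le_indicator [DecidableEq (LabelPat F ν p g)] (A₁ : ℝ) (hζu : IsZetaUnity F N ν M ζ) (hζ : IsZetaAbsLeOne F N ν M ζ)
    (E : (j : ℕ) → (Fin j → LabelPat F ν p g) → Finset (LbOfRecord F ν p g j)) (j : ℕ) (h : Fin j → LabelPat F ν p g)
    (D : Finset (Iχ F ν p g j)) (hE : ∀ t ∈ E j h, D ⊆ t.1) (R : Iχ F ν p g j → Finset (Plaq (F.P p.K) (j + 1))) (ε : ℝ)
    (hreg : ∀ c ∈ D, ∀ V' : GaugeField (F.P p.K) (j + 1) (SU N),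
      (∀ p' ∈ R c, dist1 (GaugeField.plaqHol V' p') < ε) → chiFactor F N ν p g j c V' = 1)
    (U : cfgOfRecord F N p.K j) :
    ∑ q ∈ (labelTowerOfRecord F N ν M p g A₁ ζ).branch j h ∩ labelPattern F ν p g E j h, labelChi F N ν M p g A₁ ζ j h q U ≤
      Set.indicator {V' : GaugeField (F.P p.K) (j + 1) (SU N) | ∀ c ∈ D, ∃ p' ∈ R c, ε ≤ dist1 (GaugeField.plaqHol V' p')}
        (fun _ => (1 : ℝ)) ((avOfRecord F N p.K j).avg U) := by
  rw [hread_labelTower F N ν M p g A₁ hζu hζ E j h U]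
  exact (le_abs_self _).trans (abs_sum_ωOfRecord_sub_le_indicator F N ν M p g j A₁ hζ (zeta_nonneg_of_laws F N ν M hζu hζ)
    (seqOfHist F ν M p g j h) D (E j h) hE R ε hreg U _)

/-- **A FREE LEVEL SUMS TO ONE**: if the family at level `j` after `h` is ALL labels (`E j h = univ`), the pinned sum is the decomposition of unity
(`hunit_labelTower`). [folklore] -/
theorem sum_labelChi_free_eq_one [DecidableEq (LabelPat F ν p g)] (A₁ : ℝ) (hζu : IsZetaUnity F N ν M ζ) (hζ : IsZetaAbsLeOne F N ν M ζ)
    (E : (j : ℕ) → (Fin j → LabelPat F ν p g) → Finset (LbOfRecord F ν p g j)) (j : ℕ) (h : Fin j → LabelPat F ν p g)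
    (hEj : E j h = Finset.univ) (U : cfgOfRecord F N p.K j) :
    ∑ q ∈ (labelTowerOfRecord F N ν M p g A₁ ζ).branch j h ∩ labelPattern F ν p g E j h, labelChi F N ν M p g A₁ ζ j h q U = 1 := by
  have hb : (labelTowerOfRecord F N ν M p g A₁ ζ).branch j h ∩ labelPattern F ν p g E j h = (labelTowerOfRecord F N ν M p g A₁ ζ).branch j h := by
    rw [branch_inter_labelPattern, labelPattern, hEj, branch_eq]
  rw [hb]
  exact hunit_labelTower F N ν M p g A₁ hζu hζ j h U

/-- The indicator letter of a measurable coarse event, read through the averaging of record, is bounded measurable. [folklore] -/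
theorem indicator_comp_avg_good (j : ℕ) {A : Set (cfgOfRecord F N p.K (j + 1))} (hA : MeasurableSet A) :
    (bddMeas (cfgOfRecord F N p.K j)).Gd fun U => A.indicator (fun _ => (1 : ℝ)) ((avOfRecord F N p.K j).avg U) := by
  refine ⟨(measurable_const.indicator hA).comp (avOfRecord_measurable F N p.K j), 1, fun U => ?_⟩
  show |A.indicator (fun _ => (1 : ℝ)) ((avOfRecord F N p.K j).avg U)| ≤ 1
  by_cases hU : (avOfRecord F N p.K j).avg U ∈ A
  · rw [Set.indicator_of_mem hU, abs_one]
  · rw [Set.indicator_of_notMem hU, abs_zero]; exact zero_le_one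

end Letters

/-! ## §2 THE REDUCTION: the class weight of a multi-level pinned pattern is at most the Gibbs probability of the joint coarse event -/

section Reduction

variable {A₁ : ℝ} {ζ : ZetaOfRecord F N ν M}

/-- The joint coarse large-field event of the pinned levels, read on the bare field through the iterated block averages, is measurable. [folklore] -/
theorem measurableSet_jointEvent (J : Finset ℕ) (D : (j : ℕ) → Finset (Iχ F ν p g j))
    (R : (j : ℕ) → Iχ F ν p g j → Finset (Plaq (F.P p.K) (j + 1))) (ε : ℕ → ℝ) (K' : ℕ) :
    MeasurableSet {U : cfgOfRecord F N p.K 0 | ∀ j ∈ J, j < K' → ∀ c ∈ D j, ∃ p' ∈ R j c,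
      ε j ≤ dist1 (GaugeField.plaqHol (iterMap (fun i => (avOfRecord F N p.K i).avg) (j + 1) U) p')} := by
  have e : {U : cfgOfRecord F N p.K 0 | ∀ j ∈ J, j < K' → ∀ c ∈ D j, ∃ p' ∈ R j c,
      ε j ≤ dist1 (GaugeField.plaqHol (iterMap (fun i => (avOfRecord F N p.K i).avg) (j + 1) U) p')} =
      ⋂ j ∈ J, {U | j < K' → ∀ c ∈ D j, ∃ p' ∈ R j c,
        ε j ≤ dist1 (GaugeField.plaqHol (iterMap (fun i => (avOfRecord F N p.K i).avg) (j + 1) U) p')} := by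
    ext U; simp only [Set.mem_setOf_eq, Set.mem_iInter]
  rw [e]
  refine Finset.measurableSet_biInter J fun j _ => ?_
  by_cases hj : j < K'
  · have e2 : {U : cfgOfRecord F N p.K 0 | j < K' → ∀ c ∈ D j, ∃ p' ∈ R j c,
        ε j ≤ dist1 (GaugeField.plaqHol (iterMap (fun i => (avOfRecord F N p.K i).avg) (j + 1) U) p')} =
        (iterMap (fun i => (avOfRecord F N p.K i).avg) (j + 1)) ⁻¹'
          {V' : GaugeField (F.P p.K) (j + 1) (SU N) | ∀ c ∈ D j, ∃ p' ∈ R j c, ε j ≤ dist1 (GaugeField.plaqHol V' p')} := by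
      ext U; simp only [Set.mem_setOf_eq, Set.mem_preimage, hj, forall_true_left]
    rw [e2]
    exact (measurableSet_forall_exists_largeField F N ν p g (j + 0) (D j) (R j) (ε j)).preimage
      (measurable_iterMap_avOfRecord F N p.K (j + 1))
  · have e2 : {U : cfgOfRecord F N p.K 0 | j < K' → ∀ c ∈ D j, ∃ p' ∈ R j c,
        ε j ≤ dist1 (GaugeField.plaqHol (iterMap (fun i => (avOfRecord F N p.K i).avg) (j + 1) U) p')} = Set.univ := by
      ext U; simp only [Set.mem_setOf_eq, hj, IsEmpty.forall_iff, Set.mem_univ]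
    rw [e2]
    exact MeasurableSet.univ

open Classical in
/-- ★★★ **THE CLASS WEIGHT OF A MULTI-LEVEL PINNED LABEL PATTERN IS AT MOST THE WILSON–GIBBS PROBABILITY OF THE JOINT COARSE LARGE-FIELD EVENT OF ITS
PINNED LEVELS, TIMES `∫ρ₀`.**  On the torus `F.P K`, for every bare coupling `g₀`, normalisation `E₀`, `A₁`, residual factor `ζ` obeying the two
displayed laws with (O4)-measurable label weights; for a finite set `J` of pinned levels with level-indexed families `D j` of χ_{j+1}-cubes, letter regions
`R j c` and thresholds `ε j` obeying the regularity letters; for every cutoff `K′` and every label-family pattern `E` pinning `D j` at the levels `j ∈ J`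
(`t ∈ E j h → D j ⊆ P(t)`) and FREE elsewhere (`E j h = univ`, `j ∉ J`):
`Σ_{h ∈ admS (labelTowerOfRecord A₁ ζ) (labelPattern E) K′} ∫ eterm ρ₀ K′ h dμ_{K′}
   ≤ (gibbsMeasure (F.P K) g₀⁻²){U | ∀ j ∈ J, j < K′ → ∀ c ∈ D j, ∃ p′ ∈ R j c, ε j ≤ |Ū^{j+1}U(∂p′) − 1|} · ∫ ρ₀ dU₀`
(`ρ₀ = rhoZeroOfRecord g₀ E₀`, `Ū^{j} = iterMap avg j U`): generation 5's `sum_admS_integral_le_integral_prod` on the label tower (`hmod_labelTower`) with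
the letters of §1, the product of the indicators bounded by the indicator of the joint event, and `∫_S ρ₀ = μ_{g₀⁻²}(S)·∫ρ₀`. [folklore] -/
theorem sum_admS_integral_labelTower_le_gibbsReal_mul (g₀ E₀ A₁ : ℝ) (hζu : IsZetaUnity F N ν M ζ) (hζ : IsZetaAbsLeOne F N ν M ζ)
    (hω : ∀ (k : ℕ) (s : SeqOfRecord F ν M g p.K k) (t : LbOfRecord F ν p g k),
      Measurable fun z : cfgOfRecord F N p.K (k + 1) × cfgOfRecord F N p.K k => ωOfRecord F N ν M p g k A₁ ζ s t z.2 z.1)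
    (J : Finset ℕ) (D : (j : ℕ) → Finset (Iχ F ν p g j)) (R : (j : ℕ) → Iχ F ν p g j → Finset (Plaq (F.P p.K) (j + 1))) (ε : ℕ → ℝ)
    (hreg : ∀ j ∈ J, ∀ c ∈ D j, ∀ V' : GaugeField (F.P p.K) (j + 1) (SU N),
      (∀ p' ∈ R j c, dist1 (GaugeField.plaqHol V' p') < ε j) → chiFactor F N ν p g j c V' = 1)
    (E : (j : ℕ) → (Fin j → LabelPat F ν p g) → Finset (LbOfRecord F ν p g j))
    (hEpin : ∀ j ∈ J, ∀ h t, t ∈ E j h → D j ⊆ t.1) (hEfree : ∀ j, j ∉ J → ∀ h, E j h = Finset.univ) (K' : ℕ) :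
    ∑ h ∈ admS (labelTowerOfRecord F N ν M p g A₁ ζ) (labelPattern F ν p g E) K',
        ∫ x, (labelTowerOfRecord F N ν M p g A₁ ζ).eterm (rhoZeroOfRecord F N p.K g₀ E₀) K' h x ∂(lawOfRecord F N p.K K') ≤
      (T4GenFunBounds.gibbsMeasure (F.P p.K) (g₀⁻¹ ^ 2) : Measure (cfgOfRecord F N p.K 0)).real
          {U | ∀ j ∈ J, j < K' → ∀ c ∈ D j, ∃ p' ∈ R j c,
            ε j ≤ dist1 (GaugeField.plaqHol (iterMap (fun i => (avOfRecord F N p.K i).avg) (j + 1) U) p')} *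
        ∫ U, rhoZeroOfRecord F N p.K g₀ E₀ U ∂(fieldMeasure (F.P p.K) 0 (SU N)) := by
  -- abbreviations
  set T := labelTowerOfRecord F N ν M p g A₁ ζ with hT
  set ρ₀ := rhoZeroOfRecord F N p.K g₀ E₀ with hρ₀
  have hρ : (bddMeas (cfgOfRecord F N p.K 0)).Gd ρ₀ := rhoZeroOfRecord_good F N p.K g₀ E₀
  have h0 : ∀ U, 0 ≤ ρ₀ U := fun U => (rhoZeroOfRecord_pos F N p.K g₀ E₀ U).le
  -- the coarse events and the letters: indicators at the pinned levels, `1` at the free ones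
  let A : (j : ℕ) → Set (cfgOfRecord F N p.K (j + 1)) := fun j =>
    {V' | ∀ c ∈ D j, ∃ p' ∈ R j c, ε j ≤ dist1 (GaugeField.plaqHol V' p')}
  have hA : ∀ j, MeasurableSet (A j) := fun j => measurableSet_forall_exists_largeField F N ν p g j (D j) (R j) (ε j)
  let e : (j : ℕ) → cfgOfRecord F N p.K j → ℝ := fun j U =>
    if j ∈ J then (A j).indicator (fun _ => (1 : ℝ)) ((avOfRecord F N p.K j).avg U) else 1
  have he : ∀ j U, 0 ≤ e j U := fun j U => by
    by_cases hj : j ∈ J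
    · simp only [e, if_pos hj]; exact Set.indicator_nonneg (fun _ _ => zero_le_one) _
    · simp only [e, if_neg hj]; exact zero_le_one
  have he1 : ∀ j U, e j U ≤ 1 := fun j U => by
    by_cases hj : j ∈ J
    · simp only [e, if_pos hj]; exact Set.indicator_le_self' (fun _ _ => zero_le_one) _
    · simp only [e, if_neg hj]; exact le_rfl
  have heg : ∀ j, (bddMeas (cfgOfRecord F N p.K j)).Gd (e j) := fun j => by
    by_cases hj : j ∈ J
    · simpa only [e, if_pos hj] using indicator_comp_avg_good F N p j (hA j)
    · simpa only [e, if_neg hj] using (bddMeas (cfgOfRecord F N p.K j)).const 1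
  -- the pinned-sum letters at every level
  have hpin : ∀ (j : ℕ) (h : Fin j → LabelPat F ν p g), j < K' → h ∈ admS T (labelPattern F ν p g E) j →
      ∀ U, ∑ q ∈ T.branch j h ∩ labelPattern F ν p g E j h, labelChi F N ν M p g A₁ ζ j h q U ≤ e j U := by
    intro j h _ _ U
    by_cases hj : j ∈ J
    · simp only [e, if_pos hj]
      exact sum_labelChi_pinned_le_indicator F N ν M p g A₁ hζu hζ E j h (D j) (hEpin j hj h) (R j) (ε j) (hreg j hj) U
    · simp only [e, if_neg hj]
      exact (sum_labelChi_free_eq_one F N ν M p g A₁ hζu hζ E j h (hEfree j hj h) U).le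
  -- generation 5's module 2 on the label tower
  have key := sum_admS_integral_le_integral_prod T (lawOfRecord F N p.K) (fun j => (avOfRecord F N p.K j).avg)
    (labelChi F N ν M p g A₁ ζ) (labelPattern F ν p g E) e (fun j m hm => good_comp_avOfRecord F N p.K j m hm)
    (labelChi_good F N ν M p g hω) (labelChi_nonneg F N ν M p g) (hmod_labelTower F N ν M p g hω) hρ h0
    (fun f hf => integrable_of_bddMeas _ hf) he heg K' hpin
  rw [lawOfRecord_zero] at key
  refine key.trans ?_
  -- the product of the letters is at most the indicator of the joint event
  set S : Set (cfgOfRecord F N p.K 0) := {U | ∀ j ∈ J, j < K' → ∀ c ∈ D j, ∃ p' ∈ R j c,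
    ε j ≤ dist1 (GaugeField.plaqHol (iterMap (fun i => (avOfRecord F N p.K i).avg) (j + 1) U) p')} with hS
  have hSm : MeasurableSet S := measurableSet_jointEvent F N ν p g J D R ε K'
  have hρint : Integrable ρ₀ (fieldMeasure (F.P p.K) 0 (SU N)) := integrable_of_bddMeas _ hρ
  have hpt : ∀ U, (∏ j ∈ Finset.range K', e j (iterMap (fun i => (avOfRecord F N p.K i).avg) j U)) * ρ₀ U ≤ S.indicator ρ₀ U := by
    intro U
    by_cases hU : U ∈ S
    · rw [Set.indicator_of_mem hU]
      refine mul_le_of_le_one_left (h0 U) (Finset.prod_le_one (fun j _ => he j _) fun j _ => he1 j _)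
    · rw [Set.indicator_of_notMem hU]
      have hU' : ∃ j ∈ J, j < K' ∧ ¬ ∀ c ∈ D j, ∃ p' ∈ R j c,
          ε j ≤ dist1 (GaugeField.plaqHol (iterMap (fun i => (avOfRecord F N p.K i).avg) (j + 1) U) p') := by
        by_contra hcon
        push Not at hcon
        exact hU fun j hj hjK => hcon j hj hjK
      obtain ⟨j, hj, hjK, hnot⟩ := hU'
      have hnot' : (avOfRecord F N p.K j).avg (iterMap (fun i => (avOfRecord F N p.K i).avg) j U) ∉ A j := hnot
      have hz : e j (iterMap (fun i => (avOfRecord F N p.K i).avg) j U) = 0 := by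
        simp only [e, if_pos hj]
        exact Set.indicator_of_notMem hnot' _
      rw [Finset.prod_eq_zero (Finset.mem_range.2 hjK) hz, zero_mul]
  calc ∫ U, (∏ j ∈ Finset.range K', e j (iterMap (fun i => (avOfRecord F N p.K i).avg) j U)) * ρ₀ U ∂(fieldMeasure (F.P p.K) 0 (SU N))
      ≤ ∫ U, S.indicator ρ₀ U ∂(fieldMeasure (F.P p.K) 0 (SU N)) :=
        integral_mono (integrable_of_bddMeas _ ((bddMeas _).mul
          (good_prod_iterMap (𝒢 := fun j => bddMeas (cfgOfRecord F N p.K j)) (avg := fun j => (avOfRecord F N p.K j).avg)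
            (fun j m hm => good_comp_avOfRecord F N p.K j m hm) heg K') hρ)) (hρint.indicator hSm) hpt
    _ = ∫ U in S, ρ₀ U ∂(fieldMeasure (F.P p.K) 0 (SU N)) := integral_indicator hSm
    _ = (T4GenFunBounds.gibbsMeasure (F.P p.K) (g₀⁻¹ ^ 2) : Measure (cfgOfRecord F N p.K 0)).real S *
          ∫ U, ρ₀ U ∂(fieldMeasure (F.P p.K) 0 (SU N)) := setIntegral_rhoZeroOfRecord F N p.K g₀ E₀ hSm

end Reduction

/-! ## §3 ONE PINNED LEVEL `k`, ANY `k`: one Peierls factor per pinned cube, unconditionally -/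

section OneLevel

/-- The tower's iterated level map at the averagings of record IS Bałaban's `k`-fold (0.4) block average of module 7 ∕ 8's statements. [folklore] -/
theorem iterMap_avOfRecord_eq (K k : ℕ) :
    iterMap (fun i => (avOfRecord F N K i).avg) k =
      Averaging.iter (P := F.P K) (G := SU N) (fun _ => BlockAveraging.blockAvg ExpMeanLog.expMeanLogSU) k := by
  rw [iterMap_avg_eq_iter]; rfl

open Classical in
/-- ★★★ **KEYS ROOTED AT ANY ONE LEVEL `k` ON BAŁABAN's LABEL TOWER, BY VALUE — NO «LCS-k».**  For every `N ≥ 1`, torus family `F` and level `k` there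
are `δ₀ > 0`, `C ≥ 0` (module 8's level-`(k+1)` cells-Peierls constants, functions of `N`, `F.L`, `k`) such that: for `k < K`, `g₀⁻² ≥ 4N`, every `E₀`,
`A₁`, every `ζ` obeying the two displayed laws with (O4)-measurable label weights, every finite family `D` of χ_{k+1}-cubes with regularity letters on
pairwise disjoint regions `R c` of at most `m` level-`(k+1)` plaquettes, `ε″ ≥ 0`, every cutoff `K′ > k` and every label-family pattern `E` pinning `D`
at level `k` (`t ∈ E k h → D ⊆ P(t)`) and free at every other level (`E j h = univ`, `j ≠ k`):
`Σ_{h ∈ admS (labelTowerOfRecord A₁ ζ) (labelPattern E) K′} ∫ eterm ρ₀ K′ h dμ_{K′} ≤ (m·e^{Cδ₀ − δ₀g₀⁻²ε″²∕(2N)})^{#D} · ∫ ρ₀ dU₀`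
— n20-c module 30's class weight bound for keys rooted at a LATER step, for the initial density of record, with its «LCS-k» hypothesis REMOVED:
§2 with `J = {k}` and module 8's `gibbsMeasure_largeFieldCells_dist1_iterAvgFun_le` at level `k + 1`. [folklore] -/
theorem sum_admS_integral_le_labelTower_pinnedLevel_byValue (k : ℕ) :
    ∃ δ₀ : ℝ, 0 < δ₀ ∧ ∃ C : ℝ, 0 ≤ C ∧ ∀ (_hk : k < p.K) (g₀ E₀ : ℝ), 4 * N ≤ g₀⁻¹ ^ 2 →
      ∀ (A₁ : ℝ) {ζ : ZetaOfRecord F N ν M}, IsZetaUnity F N ν M ζ → IsZetaAbsLeOne F N ν M ζ →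
      (∀ (k : ℕ) (s : SeqOfRecord F ν M g p.K k) (t : LbOfRecord F ν p g k),
        Measurable fun z : cfgOfRecord F N p.K (k + 1) × cfgOfRecord F N p.K k => ωOfRecord F N ν M p g k A₁ ζ s t z.2 z.1) →
      ∀ (D : Finset (Iχ F ν p g k)) (R : Iχ F ν p g k → Finset (Plaq (F.P p.K) (k + 1))) (m : ℕ) (ε'' : ℝ), 0 ≤ ε'' →
        (∀ c ∈ D, (R c).card ≤ m) → (∀ c₁ ∈ D, ∀ c₂ ∈ D, c₁ ≠ c₂ → Disjoint (R c₁) (R c₂)) →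
        (∀ c ∈ D, ∀ V' : GaugeField (F.P p.K) (k + 1) (SU N),
          (∀ p' ∈ R c, dist1 (GaugeField.plaqHol V' p') < ε'') → chiFactor F N ν p g k c V' = 1) →
      ∀ (K' : ℕ), k < K' → ∀ (E : (j : ℕ) → (Fin j → LabelPat F ν p g) → Finset (LbOfRecord F ν p g j)),
        (∀ h t, t ∈ E k h → D ⊆ t.1) → (∀ j h, j ≠ k → E j h = Finset.univ) →
        ∑ h ∈ admS (labelTowerOfRecord F N ν M p g A₁ ζ) (labelPattern F ν p g E) K',
            ∫ x, (labelTowerOfRecord F N ν M p g A₁ ζ).eterm (rhoZeroOfRecord F N p.K g₀ E₀) K' h x ∂(lawOfRecord F N p.K K') ≤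
          ((m : ℝ) * Real.exp (C * δ₀ - δ₀ * g₀⁻¹ ^ 2 * (ε'' ^ 2 / (2 * (Fintype.card (Fin N) : ℝ))))) ^ D.card *
            ∫ U, rhoZeroOfRecord F N p.K g₀ E₀ U ∂(fieldMeasure (F.P p.K) 0 (SU N)) := by
  obtain ⟨δ₀, hδ₀, C, hC, h8⟩ := gibbsMeasure_largeFieldCells_dist1_iterAvgFun_le N F.L (k + 1)
  refine ⟨δ₀, hδ₀, C, hC, fun hk g₀ E₀ hg A₁ ζ hζu hζ hω D R m ε'' hε hm hdisj hreg K' hkK E hEk hEfree => ?_⟩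
  -- the single pinned level as a level-indexed family
  set D' : (j : ℕ) → Finset (Iχ F ν p g j) := Function.update (fun _ => ∅) k D with hD'def
  set R' : (j : ℕ) → Iχ F ν p g j → Finset (Plaq (F.P p.K) (j + 1)) := Function.update (fun _ _ => ∅) k R with hR'def
  have hD' : D' k = D := by rw [hD'def, Function.update_self]
  have hR' : R' k = R := by rw [hR'def, Function.update_self]
  have hreg' : ∀ j ∈ ({k} : Finset ℕ), ∀ c ∈ D' j, ∀ V' : GaugeField (F.P p.K) (j + 1) (SU N),
      (∀ p' ∈ R' j c, dist1 (GaugeField.plaqHol V' p') < ε'') → chiFactor F N ν p g j c V' = 1 := by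
    intro j hj
    rw [Finset.mem_singleton] at hj
    subst hj
    rw [hD', hR']
    exact hreg
  have hEpin : ∀ j ∈ ({k} : Finset ℕ), ∀ h t, t ∈ E j h → D' j ⊆ t.1 := by
    intro j hj
    rw [Finset.mem_singleton] at hj
    subst hj
    rw [hD']
    exact hEk
  have hEfree' : ∀ j, j ∉ ({k} : Finset ℕ) → ∀ h, E j h = Finset.univ :=
    fun j hj h => hEfree j h fun e => hj (Finset.mem_singleton.2 e)
  have key := sum_admS_integral_labelTower_le_gibbsReal_mul F N ν M p g g₀ E₀ A₁ hζu hζ hω {k} D' R' (fun _ => ε'') hreg' E hEpin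
    hEfree' K'
  refine key.trans (mul_le_mul_of_nonneg_right ?_ (integral_nonneg fun U => (rhoZeroOfRecord_pos F N p.K g₀ E₀ U).le))
  -- the joint event of the one pinned level is the cells event of `Ū^{k+1}`
  have hsub : {U : cfgOfRecord F N p.K 0 | ∀ j ∈ ({k} : Finset ℕ), j < K' → ∀ c ∈ D' j, ∃ p' ∈ R' j c,
        ε'' ≤ dist1 (GaugeField.plaqHol (iterMap (fun i => (avOfRecord F N p.K i).avg) (j + 1) U) p')} ⊆
      {U : GaugeField (F.P p.K) 0 (Matrix.specialUnitaryGroup (Fin N) ℂ) | ∀ c ∈ D, ∃ p' ∈ R c,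
        ε'' ≤ dist1 (GaugeField.plaqHol
          (Averaging.iter (fun _ => BlockAveraging.blockAvg (ExpMeanLog.expMeanLogSU (n := Fin N))) (k + 1) U) p')} := by
    intro U hU
    have hUk := hU k (Finset.mem_singleton_self k) hkK
    rw [hD'] at hUk
    intro c hc
    obtain ⟨p', hp', hle⟩ := hUk c hc
    refine ⟨p', by rw [hR'] at hp'; exact hp', ?_⟩
    rw [iterMap_avOfRecord_eq] at hle
    exact hle
  have hmK : k + 1 ≤ (F.P p.K).m + (F.P p.K).K := by
    simp only [T4Family.P_m, T4Family.P_K]; omega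
  haveI := T4GenFunBounds.isProbabilityMeasure_gibbsMeasure (G := SU N) (F.P p.K) (sq_nonneg g₀⁻¹)
  exact (measureReal_mono hsub (measure_ne_top _ _)).trans
    (h8 (F.P p.K) (T4Family.P_d F p.K) (T4Family.P_L F p.K) hmK (g₀⁻¹ ^ 2) hg ε'' hε D R m hm hdisj)

open Classical in
/-- ★ **THE RELATIVE FORM — END2's `extractA` SHAPE** («the class's partial sum is at most `q` times the full sum», here `q = (m·r_{k+1})^{#D}` for a
key rooted at ANY level `k`): with the binders of `sum_admS_integral_le_labelTower_pinnedLevel_byValue`,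
`Σ_{h ∈ admS … K′} ∫ eterm ρ₀ K′ h dμ_{K′} ≤ (m·e^{Cδ₀ − δ₀g₀⁻²ε″²∕(2N)})^{#D} · Σ_{h ∈ adm K′} ∫ eterm ρ₀ K′ h dμ_{K′}` (the full sum IS `∫ρ₀ dU₀` by n20-c's
`sum_adm_integral_eterm_labelTower`). [folklore] -/
theorem sum_admS_integral_le_mul_sum_adm_labelTower_pinnedLevel_byValue (k : ℕ) :
    ∃ δ₀ : ℝ, 0 < δ₀ ∧ ∃ C : ℝ, 0 ≤ C ∧ ∀ (_hk : k < p.K) (g₀ E₀ : ℝ), 4 * N ≤ g₀⁻¹ ^ 2 →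
      ∀ (A₁ : ℝ) {ζ : ZetaOfRecord F N ν M}, IsZetaUnity F N ν M ζ → IsZetaAbsLeOne F N ν M ζ →
      (∀ (k : ℕ) (s : SeqOfRecord F ν M g p.K k) (t : LbOfRecord F ν p g k),
        Measurable fun z : cfgOfRecord F N p.K (k + 1) × cfgOfRecord F N p.K k => ωOfRecord F N ν M p g k A₁ ζ s t z.2 z.1) →
      ∀ (D : Finset (Iχ F ν p g k)) (R : Iχ F ν p g k → Finset (Plaq (F.P p.K) (k + 1))) (m : ℕ) (ε'' : ℝ), 0 ≤ ε'' →
        (∀ c ∈ D, (R c).card ≤ m) → (∀ c₁ ∈ D, ∀ c₂ ∈ D, c₁ ≠ c₂ → Disjoint (R c₁) (R c₂)) →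
        (∀ c ∈ D, ∀ V' : GaugeField (F.P p.K) (k + 1) (SU N),
          (∀ p' ∈ R c, dist1 (GaugeField.plaqHol V' p') < ε'') → chiFactor F N ν p g k c V' = 1) →
      ∀ (K' : ℕ), k < K' → ∀ (E : (j : ℕ) → (Fin j → LabelPat F ν p g) → Finset (LbOfRecord F ν p g j)),
        (∀ h t, t ∈ E k h → D ⊆ t.1) → (∀ j h, j ≠ k → E j h = Finset.univ) →
        ∑ h ∈ admS (labelTowerOfRecord F N ν M p g A₁ ζ) (labelPattern F ν p g E) K',
            ∫ x, (labelTowerOfRecord F N ν M p g A₁ ζ).eterm (rhoZeroOfRecord F N p.K g₀ E₀) K' h x ∂(lawOfRecord F N p.K K') ≤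
          ((m : ℝ) * Real.exp (C * δ₀ - δ₀ * g₀⁻¹ ^ 2 * (ε'' ^ 2 / (2 * (Fintype.card (Fin N) : ℝ))))) ^ D.card *
            ∑ h ∈ (labelTowerOfRecord F N ν M p g A₁ ζ).adm K',
              ∫ x, (labelTowerOfRecord F N ν M p g A₁ ζ).eterm (rhoZeroOfRecord F N p.K g₀ E₀) K' h x ∂(lawOfRecord F N p.K K') := by
  obtain ⟨δ₀, hδ₀, C, hC, h⟩ := sum_admS_integral_le_labelTower_pinnedLevel_byValue F N ν M p g k
  refine ⟨δ₀, hδ₀, C, hC, fun hk g₀ E₀ hg A₁ ζ hζu hζ hω D R m ε'' hε hm hdisj hreg K' hkK E hEk hEfree => ?_⟩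
  rw [sum_adm_integral_eterm_labelTower F N ν M p g A₁ hζu hζ hω (rhoZeroOfRecord_good F N p.K g₀ E₀) K']
  exact h hk g₀ E₀ hg A₁ hζu hζ hω D R m ε'' hε hm hdisj hreg K' hkK E hEk hEfree

end OneLevel

end Summit.QuantumFields.YangMills.BalabanUVNodes.N20ByValueLabelTowerPinned

end
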